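import Summits.CriticalPhenomena.PercolationContinuityZ3.Theorems.PercNearOneGluingNoHeavyLowerTailKNGoodPocketBHKTwoSets
import Literature.Probability.Percolation.PercolationEvents
import Literature.Probability.LatticeModels.ProdBernoulliIndependence
import HarnessLib

/-!
# `NoHeavyLowerTail` (stmt-CriticalPhenomena-4575) — the TILTING LEMMA for two relays competing for a target
# (pocket-augmented BHK, twice)

Support file (`--supports stmt-CriticalPhenomena-4575`, hull-port prover `prim-hp-2`, gen 23).  No definitions, no named
facts, no sorries; standard axioms.

* `KNGoodTilt.tilt` — for bond percolation on ANY finite weighted graph, vertices `o, a, b, c` and ANY family `𝒬` of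
  vertex sets missing `a` and `c`, with `F = {o ↔ a} ∪ {C(o) ∈ 𝒬}` (`KNGoodPocketBHK.pocketAugSet {a} o 𝒬`):
  if `μ(c↔b, a↮b) ≤ μ(a↔b, c↮b)` (equivalently `P(c↔b) ≤ P(a↔b)`) then `μ({c↔b, a↮b} ∩ F) ≤ μ({a↔b, c↮b} ∩ F)` —
  the event `F` tilts the competition of the relays `c, a` for `b` towards `a`.
  Proof: the pocket-augmented BHK inequality `KNGoodPocketBHK.real_pocketAugSet_openConn_ge` for the source `{a,b}` and
  sink `{c}` gives `μ(a↔b,c↮ab)·μ(M ∩ F) ≤ μ(M)·μ({a↔b,c↮ab} ∩ F)` with `M = {a,b,c pairwise separated}`; for the source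
  `{c,b}`, sink `{a}` and the COMPLEMENTARY family it gives `μ(M)·μ({c↔b,a↮cb} ∩ F) ≤ μ(c↔b,a↮cb)·μ(M ∩ F)`; chain and
  cancel `μ(M)` (if `μ(M) = 0`, Harris' inequality kills one side).
This is the engine of `KNGoodTwoRelaysGeneral.knGood_pair` (every quadruple with two relays is Kozma–Nitzan-good, no
separation) and of the gen-23 programme "goodness with `b ∈ A`" (prim-hp-2 MEMO-gen23).
[cite: VandenbergHaggstromKahn2005, Thm. 1.1 (pp. 3–5), Remark 1 (p. 5)] [cite: KozmaNitzan2024, §3.2 (p. 12), Thm. 1 (p. 7)]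
-/

noncomputable section

namespace Summit.CriticalPhenomena.PercolationContinuityZ3.Theorems

open MeasureTheory Set Literature.Probability.LatticeModels Literature.Probability.Percolation
open scoped Classical

namespace KNGoodTilt

open KNGoodPocketBHK

variable {V : Type*} [Fintype V]

/-! ### The tilting lemma -/

/-- **Tilting lemma.**  `o, a, b, c` vertices, `𝒬` any family of vertex sets missing `a` and `c`,
`F = {o ↔ a} ∪ {C(o) ∈ 𝒬}` (`= KNGoodPocketBHK.pocketAugSet {a} o 𝒬`).  If `μ(c↔b, a↮b) ≤ μ(a↔b, c↮b)` then
`μ({c↔b, a↮b} ∩ F) ≤ μ({a↔b, c↮b} ∩ F)`.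
[cite: VandenbergHaggstromKahn2005, Thm. 1.1 (pp. 3–5), Remark 1 (p. 5)] [cite: KozmaNitzan2024, §3.2 (p. 12)] -/
theorem tilt (w : Sym2 V → unitInterval) (o a b c : V) (𝒬 : Set (Set V)) (h𝒬 : ∀ S ∈ 𝒬, a ∉ S ∧ c ∉ S)
    (hle : (prodBernoulli w).real {ω : BondConfig V | (openGraph ω).Reachable c b ∧ ¬ (openGraph ω).Reachable a b} ≤
      (prodBernoulli w).real {ω : BondConfig V | (openGraph ω).Reachable a b ∧ ¬ (openGraph ω).Reachable c b}) :
    (prodBernoulli w).real ({ω : BondConfig V | (openGraph ω).Reachable c b ∧ ¬ (openGraph ω).Reachable a b} ∩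
        pocketAugSet {a} o 𝒬) ≤
      (prodBernoulli w).real ({ω : BondConfig V | (openGraph ω).Reachable a b ∧ ¬ (openGraph ω).Reachable c b} ∩
        pocketAugSet {a} o 𝒬) := by
  classical
  set μ := prodBernoulli w with hμ
  haveI : IsProbabilityMeasure μ := by rw [hμ]; infer_instance
  have hmeas : ∀ S : Set (BondConfig V), MeasurableSet S := fun _ => MeasurableSet.of_discrete
  -- events
  set Ec : Set (BondConfig V) := {ω | (openGraph ω).Reachable c b ∧ ¬ (openGraph ω).Reachable a b} with hEc
  set Ea : Set (BondConfig V) := {ω | (openGraph ω).Reachable a b ∧ ¬ (openGraph ω).Reachable c b} with hEa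
  set N₁ : Set (BondConfig V) := (openConn a b)ᶜ ∩ (openConn a c)ᶜ with hN₁
  set N₂ : Set (BondConfig V) := (openConn c b)ᶜ with hN₂
  set M : Set (BondConfig V) := N₁ ∩ N₂ with hM
  set F : Set (BondConfig V) := pocketAugSet {a} o 𝒬 with hF
  have memF : ∀ ω, ω ∈ F ↔ (openGraph ω).Reachable o a ∨ openCluster ω o ∈ 𝒬 := fun ω => by
    simp only [hF, pocketAugSet, Set.mem_setOf_eq, Set.mem_singleton_iff, exists_eq_left]
  have memM : ∀ ω, ω ∈ M ↔ ¬ (openGraph ω).Reachable a b ∧ ¬ (openGraph ω).Reachable a c ∧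
      ¬ (openGraph ω).Reachable c b := fun ω => by
    simp only [hM, hN₁, hN₂, openConn, Set.mem_inter_iff, Set.mem_compl_iff, Set.mem_setOf_eq, and_assoc]
  -- the complementary family for the second instance
  set 𝒬' : Set (Set V) := {S | a ∉ S ∧ c ∉ S ∧ S ∉ 𝒬} with h𝒬'
  have h𝒬c : ∀ S ∈ 𝒬, Disjoint S ({c} : Set V) := fun S hS => Set.disjoint_singleton_right.2 (h𝒬 S hS).2
  have h𝒬'a : ∀ S ∈ 𝒬', Disjoint S ({a} : Set V) := fun S hS => Set.disjoint_singleton_right.2 hS.1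
  ---------------------------------------------------------------- (ii): μ(Ea)·μ(M ∩ F) ≤ μ(M)·μ(Ea ∩ F)
  have key1 := real_pocketAugSet_openConn_ge w ({a, b} : Set V) {c} a b o (by simp) 𝒬 h𝒬c
  rw [← hμ] at key1
  have s1 : openConn a b ∩ avoidSet ({a, b} : Set V) {c} = Ea := by
    ext ω
    simp only [openConn, avoidSet, hEa, Set.mem_inter_iff, Set.mem_setOf_eq, Set.mem_insert_iff,
      Set.mem_singleton_iff, forall_eq_or_imp, forall_eq]
    constructor
    · rintro ⟨hab, hac, hbc⟩
      exact ⟨hab, fun hcb => hbc hcb.symm⟩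
    · rintro ⟨hab, hcb⟩
      exact ⟨hab, fun hac => hcb (hac.symm.trans hab), fun hbc => hcb hbc.symm⟩
  have s2 : avoidSet ({a, b} : Set V) {c} = Ea ∪ M := by
    ext ω
    simp only [avoidSet, hEa, memM, Set.mem_union, Set.mem_setOf_eq, Set.mem_insert_iff, Set.mem_singleton_iff,
      forall_eq_or_imp, forall_eq]
    constructor
    · rintro ⟨hac, hbc⟩
      by_cases hab : (openGraph ω).Reachable a b
      · exact Or.inl ⟨hab, fun hcb => hbc hcb.symm⟩
      · exact Or.inr ⟨hab, hac, fun hcb => hbc hcb.symm⟩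
    · rintro (⟨hab, hcb⟩ | ⟨hab, hac, hcb⟩)
      · exact ⟨fun hac => hcb (hac.symm.trans hab), fun hbc => hcb hbc.symm⟩
      · exact ⟨hac, fun hbc => hcb hbc.symm⟩
  have dEaM : Disjoint Ea M := by
    rw [Set.disjoint_left]
    intro ω h1 h2
    rw [memM] at h2
    exact h2.1 h1.1
  have s3 : openConn a b ∩ (pocketAugSet ({a, b} : Set V) o 𝒬 ∩ avoidSet ({a, b} : Set V) {c}) = Ea ∩ F := by
    rw [← Set.inter_assoc, Set.inter_comm (openConn a b), Set.inter_assoc, s1]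
    ext ω
    simp only [pocketAugSet, memF, hEa, Set.mem_inter_iff, Set.mem_setOf_eq, Set.mem_insert_iff,
      Set.mem_singleton_iff, exists_eq_or_imp, exists_eq_left]
    constructor
    · rintro ⟨hF1, hab, hcb⟩
      refine ⟨⟨hab, hcb⟩, ?_⟩
      rcases hF1 with (hoa | hob) | hq
      · exact Or.inl hoa
      · exact Or.inl (hob.trans hab.symm)
      · exact Or.inr hq
    · rintro ⟨⟨hab, hcb⟩, hF1⟩
      refine ⟨?_, hab, hcb⟩
      rcases hF1 with hoa | hq
      · exact Or.inl (Or.inl hoa)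
      · exact Or.inr hq
  have s4 : μ.real (Ea ∩ F) + μ.real (M ∩ F) ≤ μ.real (pocketAugSet ({a, b} : Set V) o 𝒬 ∩ (Ea ∪ M)) := by
    rw [← measureReal_union (dEaM.mono inter_subset_left inter_subset_left) (hmeas _)]
    refine measureReal_mono (fun ω hω => ?_)
    rw [Set.inter_comm]
    refine ⟨?_, ?_⟩
    · rcases hω with ⟨h1, h2⟩ | ⟨h1, h2⟩
      · exact Or.inl h1
      · exact Or.inr h1
    · have hF1 : ω ∈ F := by rcases hω with ⟨_, h2⟩ | ⟨_, h2⟩ <;> exact h2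
      rw [memF] at hF1
      simp only [pocketAugSet, Set.mem_setOf_eq, Set.mem_insert_iff, Set.mem_singleton_iff, exists_eq_or_imp,
        exists_eq_left]
      rcases hF1 with hoa | hq
      · exact Or.inl (Or.inl hoa)
      · exact Or.inr hq
  rw [s1, s3, s2, measureReal_union dEaM (hmeas _)] at key1
  have hii : μ.real Ea * μ.real (M ∩ F) ≤ μ.real M * μ.real (Ea ∩ F) := by
    have h0 : 0 ≤ μ.real Ea := measureReal_nonneg
    nlinarith [key1, mul_le_mul_of_nonneg_left s4 h0]
  ---------------------------------------------------------------- (i): μ(M)·μ(Ec ∩ F) ≤ μ(Ec)·μ(M ∩ F)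
  have key2 := real_pocketAugSet_openConn_ge w ({c, b} : Set V) {a} c b o (by simp) 𝒬' h𝒬'a
  rw [← hμ] at key2
  set F₂ : Set (BondConfig V) := pocketAugSet ({c, b} : Set V) o 𝒬' with hF₂
  have memF₂ : ∀ ω, ω ∈ F₂ ↔ ((openGraph ω).Reachable o c ∨ (openGraph ω).Reachable o b) ∨ openCluster ω o ∈ 𝒬' :=
    fun ω => by
      simp only [hF₂, pocketAugSet, Set.mem_setOf_eq, Set.mem_insert_iff, Set.mem_singleton_iff, exists_eq_or_imp,
        exists_eq_left]
  have t1 : openConn c b ∩ avoidSet ({c, b} : Set V) {a} = Ec := by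
    ext ω
    simp only [openConn, avoidSet, hEc, Set.mem_inter_iff, Set.mem_setOf_eq, Set.mem_insert_iff,
      Set.mem_singleton_iff, forall_eq_or_imp, forall_eq]
    constructor
    · rintro ⟨hcb, hca, hba⟩
      exact ⟨hcb, fun hab => hba hab.symm⟩
    · rintro ⟨hcb, hab⟩
      exact ⟨hcb, fun hca => hab (hca.symm.trans hcb), fun hba => hab hba.symm⟩
  have t2 : avoidSet ({c, b} : Set V) {a} = Ec ∪ M := by
    ext ω
    simp only [avoidSet, hEc, memM, Set.mem_union, Set.mem_setOf_eq, Set.mem_insert_iff, Set.mem_singleton_iff,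
      forall_eq_or_imp, forall_eq]
    constructor
    · rintro ⟨hca, hba⟩
      by_cases hcb : (openGraph ω).Reachable c b
      · exact Or.inl ⟨hcb, fun hab => hba hab.symm⟩
      · exact Or.inr ⟨fun hab => hba hab.symm, fun hac => hca hac.symm, hcb⟩
    · rintro (⟨hcb, hab⟩ | ⟨hab, hac, hcb⟩)
      · exact ⟨fun hca => hab (hca.symm.trans hcb), fun hba => hab hba.symm⟩
      · exact ⟨fun hca => hac hca.symm, fun hba => hab hba.symm⟩
  have dEcM : Disjoint Ec M := by
    rw [Set.disjoint_left]
    intro ω h1 h2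
    rw [memM] at h2
    exact h2.2.2 h1.1
  have t3 : openConn c b ∩ (F₂ ∩ avoidSet ({c, b} : Set V) {a}) = Ec ∩ F₂ := by
    rw [← Set.inter_assoc, Set.inter_comm (openConn c b), Set.inter_assoc, t1, Set.inter_comm]
  -- `Ec ∩ F` misses `F₂`, and the complement of `F₂` lies in `F`
  have t4 : Ec ∩ F ⊆ Ec \ F₂ := by
    rintro ω ⟨hE, hFω⟩
    refine ⟨hE, fun h2 => ?_⟩
    rw [memF₂] at h2
    rw [memF] at hFω
    obtain ⟨hcb, hab⟩ := hE
    rcases hFω with hoa | hq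
    · rcases h2 with (hoc | hob) | hq'
      · exact hab ((hoa.symm.trans hoc).trans hcb)
      · exact hab (hoa.symm.trans hob)
      · exact hq'.1 hoa
    · obtain ⟨haC, hcC⟩ := h𝒬 _ hq
      rcases h2 with (hoc | hob) | hq'
      · exact hcC hoc
      · exact hcC (hob.trans hcb.symm)
      · exact hq'.2.2 hq
  have t5 : M \ F₂ ⊆ M ∩ F := by
    rintro ω ⟨hMω, h2⟩
    refine ⟨hMω, ?_⟩
    rw [memF₂, not_or, not_or] at h2
    rw [memF]
    obtain ⟨⟨hoc, -⟩, hq'⟩ := h2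
    simp only [h𝒬', Set.mem_setOf_eq, not_and, not_not] at hq'
    by_cases hoa : (openGraph ω).Reachable o a
    · exact Or.inl hoa
    · exact Or.inr (hq' hoa hoc)
  rw [t1, t3, t2, measureReal_union dEcM (hmeas _)] at key2
  have u1 : μ.real (F₂ ∩ (Ec ∪ M)) = μ.real (Ec ∩ F₂) + μ.real (M ∩ F₂) := by
    rw [Set.inter_union_distrib_left, measureReal_union (dEcM.mono inter_subset_right inter_subset_right) (hmeas _),
      Set.inter_comm F₂ Ec, Set.inter_comm F₂ M]
  have u2 : μ.real (Ec ∩ F₂) + μ.real (Ec \ F₂) = μ.real Ec := measureReal_inter_add_sdiff (hmeas _)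
  have u3 : μ.real (M ∩ F₂) + μ.real (M \ F₂) = μ.real M := measureReal_inter_add_sdiff (hmeas _)
  have u4 : μ.real (Ec ∩ F) ≤ μ.real (Ec \ F₂) := measureReal_mono t4
  have u5 : μ.real (M \ F₂) ≤ μ.real (M ∩ F) := measureReal_mono t5
  rw [u1] at key2
  have hi : μ.real M * μ.real (Ec ∩ F) ≤ μ.real Ec * μ.real (M ∩ F) := by
    have h0M : 0 ≤ μ.real M := measureReal_nonneg
    have h0E : 0 ≤ μ.real Ec := measureReal_nonneg
    nlinarith [key2, mul_le_mul_of_nonneg_left u4 h0M, mul_le_mul_of_nonneg_left u5 h0E]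
  ---------------------------------------------------------------- combine
  have hMF : 0 ≤ μ.real (M ∩ F) := measureReal_nonneg
  have hchain : μ.real M * μ.real (Ec ∩ F) ≤ μ.real M * μ.real (Ea ∩ F) :=
    hi.trans ((mul_le_mul_of_nonneg_right hle hMF).trans hii)
  by_cases hM0 : μ.real M = 0
  · -- degenerate world: Harris ⟹ `μ(N₁) μ(N₂) ≤ μ(M) = 0`; `Ec ⊆ N₁`, `Ea ⊆ N₂`
    have hlow₁ : IsLowerSet N₁ := ((isUpperSet_openConn a b).compl).inter (isUpperSet_openConn a c).compl
    have hlow₂ : IsLowerSet N₂ := (isUpperSet_openConn c b).compl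
    have harris := prodBernoulli_harris_lower w hlow₁ hlow₂ (hmeas _) (hmeas _)
    rw [← hμ] at harris
    change μ.real N₁ * μ.real N₂ ≤ μ.real M at harris
    rw [hM0] at harris
    have hEcN : μ.real Ec ≤ μ.real N₁ := by
      refine measureReal_mono (fun ω hω => ?_)
      obtain ⟨hcb, hab⟩ := hω
      simp only [hN₁, openConn, Set.mem_inter_iff, Set.mem_compl_iff, Set.mem_setOf_eq]
      exact ⟨hab, fun hac => hab (hac.trans hcb)⟩
    have hEaN : μ.real Ea ≤ μ.real N₂ := by
      refine measureReal_mono (fun ω hω => ?_)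
      obtain ⟨hab, hcb⟩ := hω
      simpa only [hN₂, openConn, Set.mem_compl_iff, Set.mem_setOf_eq] using hcb
    have hEcF : μ.real (Ec ∩ F) ≤ μ.real Ec := measureReal_mono inter_subset_left
    have h0 : (0 : ℝ) ≤ μ.real (Ea ∩ F) := measureReal_nonneg
    have hN0 : μ.real N₁ = 0 ∨ μ.real N₂ = 0 := by
      rcases mul_eq_zero.1 (le_antisymm harris (mul_nonneg measureReal_nonneg measureReal_nonneg)) with h | h
      · exact Or.inl h
      · exact Or.inr h
    rcases hN0 with h | h
    · linarith
    · linarith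
  · have hMpos : 0 < μ.real M := lt_of_le_of_ne measureReal_nonneg (Ne.symm hM0)
    exact le_of_mul_le_mul_left hchain hMpos

end KNGoodTilt

end Summit.CriticalPhenomena.PercolationContinuityZ3.Theorems
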